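import Literature.Geometry.Riemannian.ShrinkerEntropyAllScalesPointwise
import Literature.Geometry.Riemannian.WeightedHeatFlowFromLinearHeat
import Literature.Geometry.Riemannian.BakryEmeryLogSobolevSemigroup
import Literature.Geometry.Riemannian.ShrinkerEntropyProofs
import HarnessLib

/-!
# Li–Wang 2020, towards Thm. 1.1 (all-scales LSI of a shrinker): the flow layer — analysis on the
# complete shrinker for the static weighted heat flow

Second proof file towards `LiWang2020_shrinkerLSI_allScales_holds` (`ShrinkerEntropyAllScales.lean`;
Y. Li, B. Wang, *Heat kernel on Ricci shrinkers*, Calc. Var. PDE 59 (2020) = arXiv:1901.05691,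
Thm. 1.1 / Prop. 5.9). In the static frame (pull-back by the self-similar diffeomorphisms `ψᵗ`,
Li–Wang's (eqn PK08_6)–(PK08_7): `θ(t) = (η₀ − t)/(1 − t)`), Perelman's monotonicity along the
conjugate heat flow of the shrinker space-time (their Thm. 4.3, Lemma 5.10) becomes a computation
along the weighted heat flow `∂ₛu = Lu`, `L = Δ_g − g⁻¹(df, d·)`, on the STATIC shrinker
`(M, g, e^{-f} dV)` — exactly the flow of their Thm. 5.4 (Bakry–Émery on shrinkers), with its
cut-offs `φ̄ʳ = η(f/r)` of bounded `Δ_f φ̄ʳ` (their §5, Lemmas 5.5–5.6). This file supplies the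
analysis of that computation on the complete non-compact shrinker, in the vocabulary of the tree's
Bakry–Émery pipeline (`BakryEmeryHeatFlow.lean`, `WeightedGreenComplete.lean`,
`WeightedHeatFlowComplete{Decay,Entropy}.lean`, `BakryEmeryLogSobolevSemigroup.lean`):

* `weightedLaplacian_gradSq_mul_exp_neg`, `fisherDensity_pointwise_le_dim` — the product rule for
  `L(|∇ℓ|² e^{-ℓ})` and **the dimensional pointwise dissipation inequality for the Fisher density**
  `∂ₜQ ≤ LQ − 2KQ − (2/n)(Δ_g ℓ)² e^{-ℓ}`, `Q = |∇ℓ|² e^{-ℓ} = |∇u|²/u` (Li–Wang's (BE4) with the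
  Hessian term kept through `|Hess|² ≥ (tr Hess)²/n`, `fisher_pointwise_le_dim`);
* `integral_cutoff_mul_weightedLaplacian`, `integral_mul_weightedLaplacian_cutoff`,
  `integral_cutoff_mul_weightedLaplacian_symm` — Green's identities for `L` against a compactly
  supported cut-off, and the symmetry `∫ χ (LQ) e^{-V} = ∫ Q (Lχ) e^{-V}` (Li–Wang, proof of
  Lemma 5.6);
* `hasDerivAt_integral_cutoff`, `continuousOn_integral_cutoff` — the Leibniz rule and continuity in
  time for `∫ χ G(t, ·) w` with `χ` compactly supported (no growth conditions needed);
* `exists_cutoffProfile₂`, `exists_shrinkerCutoff` — Li–Wang's cut-offs `φ̄ʳ = η(f/r)`: smooth,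
  compactly supported (properness of `f`), `= 1` on `{f ≤ r}`, with `|Lφ̄ʳ| ≤ C`, `Lφ̄ʳ = 0` on
  `{f < r}` (from `Lf = n/2 − f`, `|∇f|² ≤ f`, `R ≥ 0`);
* `integral_mul_weightedLaplacian_of_proper` — Green's identity `∫ a (Lb) e^{-V} = −∫ g⁻¹(da, db) e^{-V}`
  on the manifold exhausted by the proper potential, under integrability hypotheses (from
  `CarrilloNi2009_shrinkerLSI.integral_mul_dalembertian_eq_neg_integral_innerDual_of_proper`);
* `integrable_sq_potential_mul_exp_neg` — `f² e^{-f} ∈ L¹` on a shrinker with proper potential and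
  `R ≥ 0` (weighted-volume trick with antitone cut-offs and Fatou).

Theorems only; no definitions, no named facts (D-0026).

## References

* [LiWang2020] Y. Li, B. Wang, Calc. Var. PDE 59 (2020) no. 194 (arXiv:1901.05691): §5, (5.1),
  Thm. 5.4 with Lemmas 5.5–5.6 and (BE4) (arXiv pp. 18–19), Prop. 5.7, Prop. 5.9, Lemma 5.10
  (p. 20). READ (held text paper:arxiv-1901.05691).
* [BakryGentilLedoux2014] D. Bakry, I. Gentil, M. Ledoux, *Analysis and Geometry of Markov Diffusion
  Operators*, Springer 2014, §3.2 (pp. 141–147), Prop. 5.7.1 (p. 268).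
* [CarrilloNi2009] J. A. Carrillo, L. Ni, Comm. Anal. Geom. 17 (2009), §§3–4.
-/

noncomputable section

open Bundle Set Function Filter Module Manifold MeasureTheory
open scoped Manifold ContDiff Topology ENNReal NNReal

namespace Literature.Geometry.Riemannian

open Lorentzian Lorentzian.PseudoRiemannianMetric CarrilloNi2009_shrinkerLSI

universe uM

section PointwiseDensity

variable {E : Type*} [NormedAddCommGroup E] [NormedSpace ℝ E] [FiniteDimensional ℝ E]
  {H : Type*} [TopologicalSpace H] {I : ModelWithCorners ℝ E H} [I.Boundaryless]
  {M : Type*} [TopologicalSpace M] [ChartedSpace H M] [IsManifold I ∞ M]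
  (g : PseudoRiemannianMetric I ∞ E (TangentSpace I : M → Type _)) [g.HasLeviCivita]

/-- **The weighted Laplacian of the Fisher density `|∇ℓ|² e^{-ℓ}`** (product rule
`L(AB) = A LB + B LA + 2 g⁻¹(dA, dB)`, `L(e^{-ℓ}) = e^{-ℓ}(|∇ℓ|² − Lℓ)`, `d(e^{-ℓ}) = −e^{-ℓ} dℓ`):
`L(|∇ℓ|² e^{-ℓ}) = e^{-ℓ} [L|∇ℓ|² − 2 g⁻¹(dℓ, d|∇ℓ|²) + |∇ℓ|² (|∇ℓ|² − Lℓ)]`. [folklore] -/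
theorem weightedLaplacian_gradSq_mul_exp_neg {ℓ V : M → ℝ} (hℓ : ContMDiff I 𝓘(ℝ, ℝ) ∞ ℓ)
    (x : M) :
    g.dalembertian (fun y ↦ g.gradSq ℓ y * Real.exp (-ℓ y)) x
      - g.innerDual x (mvfderiv I V x : TangentSpace I x →ₗ[ℝ] ℝ)
          (mvfderiv I (fun y ↦ g.gradSq ℓ y * Real.exp (-ℓ y)) x : TangentSpace I x →ₗ[ℝ] ℝ) =
      Real.exp (-ℓ x) *
        ((g.dalembertian (g.gradSq ℓ) x
            - g.innerDual x (mvfderiv I V x : TangentSpace I x →ₗ[ℝ] ℝ)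
                (mvfderiv I (g.gradSq ℓ) x : TangentSpace I x →ₗ[ℝ] ℝ))
          - 2 * g.innerDual x (mvfderiv I ℓ x : TangentSpace I x →ₗ[ℝ] ℝ)
                (mvfderiv I (g.gradSq ℓ) x : TangentSpace I x →ₗ[ℝ] ℝ)
          + g.gradSq ℓ x * (g.gradSq ℓ x
            - (g.dalembertian ℓ x - g.innerDual x (mvfderiv I V x : TangentSpace I x →ₗ[ℝ] ℝ)
                (mvfderiv I ℓ x : TangentSpace I x →ₗ[ℝ] ℝ)))) := by
  have hA : ContMDiff I 𝓘(ℝ, ℝ) ∞ (g.gradSq ℓ) := contMDiff_gradSq g hℓ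
  have hA2 : ContMDiffAt I 𝓘(ℝ, ℝ) 2 (g.gradSq ℓ) x :=
    (hA.of_le (WithTop.coe_le_coe.mpr le_top)).contMDiffAt
  have hℓ2 : ContMDiffAt I 𝓘(ℝ, ℝ) 2 ℓ x := (hℓ.of_le (WithTop.coe_le_coe.mpr le_top)).contMDiffAt
  have hB : ContMDiff I 𝓘(ℝ, ℝ) ∞ (fun y ↦ Real.exp (-ℓ y)) :=
    (Real.contDiff_exp.comp contDiff_neg).comp_contMDiff hℓ
  have hB2 : ContMDiffAt I 𝓘(ℝ, ℝ) 2 (fun y ↦ Real.exp (-ℓ y)) x :=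
    (hB.of_le (WithTop.coe_le_coe.mpr le_top)).contMDiffAt
  have hAd : MDifferentiableAt I 𝓘(ℝ, ℝ) (g.gradSq ℓ) x := hA.mdifferentiableAt (by simp)
  have hBd : MDifferentiableAt I 𝓘(ℝ, ℝ) (fun y ↦ Real.exp (-ℓ y)) x :=
    hB.mdifferentiableAt (by simp)
  have hℓd : MDifferentiableAt I 𝓘(ℝ, ℝ) ℓ x := hℓ.mdifferentiableAt (by simp)
  -- product rule for `Δ` and for `d`
  rw [dalembertian_fun_mul g hA2 hB2]
  have hd : (mvfderiv I (fun y ↦ g.gradSq ℓ y * Real.exp (-ℓ y)) x : TangentSpace I x →ₗ[ℝ] ℝ) =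
      g.gradSq ℓ x • (mvfderiv I (fun y ↦ Real.exp (-ℓ y)) x : TangentSpace I x →ₗ[ℝ] ℝ)
        + Real.exp (-ℓ x) • (mvfderiv I (g.gradSq ℓ) x : TangentSpace I x →ₗ[ℝ] ℝ) := by
    ext v
    have hm := mvfderiv_fun_mul hAd hBd
    simp only [ContinuousLinearMap.coe_coe, LinearMap.add_apply, LinearMap.smul_apply,
      smul_eq_mul]
    rw [hm]
    simp only [add_apply, smul_apply, smul_eq_mul]
  have hdB := mvfderiv_exp_neg_toLinearMap (I := I) (F := ℓ) hℓd
  have hLB := weightedLaplacian_exp_neg g (V := V) hℓ2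
  rw [hd, g.innerDual_add_right, g.innerDual_smul_right, g.innerDual_smul_right, hdB,
    g.innerDual_smul_right]
  -- `g⁻¹(d|∇ℓ|², dℓ) = g⁻¹(dℓ, d|∇ℓ|²)`
  rw [g.innerDual_comm x (mvfderiv I (g.gradSq ℓ) x : TangentSpace I x →ₗ[ℝ] ℝ)
    (mvfderiv I ℓ x : TangentSpace I x →ₗ[ℝ] ℝ)]
  -- `L(e^{-ℓ})`
  have hLB' : g.dalembertian (fun y ↦ Real.exp (-ℓ y)) x =
      Real.exp (-ℓ x) * (g.gradSq ℓ x
        - (g.dalembertian ℓ x - g.innerDual x (mvfderiv I V x : TangentSpace I x →ₗ[ℝ] ℝ)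
            (mvfderiv I ℓ x : TangentSpace I x →ₗ[ℝ] ℝ)))
        + g.innerDual x (mvfderiv I V x : TangentSpace I x →ₗ[ℝ] ℝ)
            (mvfderiv I (fun y ↦ Real.exp (-ℓ y)) x : TangentSpace I x →ₗ[ℝ] ℝ) := by
    linarith [hLB]
  rw [hLB', hdB, g.innerDual_smul_right]
  ring

/-- **The DIMENSIONAL pointwise dissipation inequality for the Fisher density** (Li–Wang 2020,
proof of Thm. 5.4, (BE4) "`□_f (|∇ρ|²/ρ) = −(2/ρ)|Hess ρ − dρ⊗dρ/ρ|² − |∇ρ|²/ρ`", combined with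
`|Hess log ρ|² ≥ (Δ log ρ)²/n` as in Perelman's entropy formula / their Lemma 5.10): for
`ℓ : ℝ → M → ℝ` smooth on `M × S` solving `∂ₜℓ = Lℓ − |∇ℓ|²` (`ℓ = −log u`, `∂ₜu = Lu`) under
`Ric + Hess V ≥ K g`, the Fisher density `Q = |∇ℓ|² e^{-ℓ} = |∇u|²/u` satisfies at every point

  `∂ₜQ ≤ LQ − 2K Q − (2/n)(Δ_g ℓ)² e^{-ℓ}`.

[cite: LiWang2020, proof of Thm. 5.4, (BE4) (arXiv p. 19) and Lemma 5.10 (p. 20)] -/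
theorem fisherDensity_pointwise_le_dim (hR : g.IsRiemannian) {V : M → ℝ} {K : ℝ}
    (hV : ContMDiff I 𝓘(ℝ, ℝ) ∞ V)
    (hRic : ∀ (y : M) (X : TangentSpace I y), K * g.val y X X ≤ g.ricci y X X + g.hessian V y X X)
    {ℓ : ℝ → M → ℝ} {S : Set ℝ} (hS : UniqueDiffOn ℝ S) (hS' : S ⊆ closure (interior S))
    (hℓ : ContMDiffOn (I.prod 𝓘(ℝ, ℝ)) 𝓘(ℝ, ℝ) ∞ (fun p : M × ℝ ↦ ℓ p.2 p.1) (univ ×ˢ S))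
    (heq : ∀ t ∈ S, ∀ y : M, derivWithin (fun s ↦ ℓ s y) S t =
      g.dalembertian (ℓ t) y
        - g.innerDual y (mvfderiv I V y : TangentSpace I y →ₗ[ℝ] ℝ)
            (mvfderiv I (ℓ t) y : TangentSpace I y →ₗ[ℝ] ℝ)
        - g.gradSq (ℓ t) y)
    (x : M) {t : ℝ} (ht : t ∈ S) :
    derivWithin (fun s ↦ g.gradSq (ℓ s) x * Real.exp (-ℓ s x)) S t ≤
      (g.dalembertian (fun y ↦ g.gradSq (ℓ t) y * Real.exp (-ℓ t y)) x
        - g.innerDual x (mvfderiv I V x : TangentSpace I x →ₗ[ℝ] ℝ)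
            (mvfderiv I (fun y ↦ g.gradSq (ℓ t) y * Real.exp (-ℓ t y)) x :
              TangentSpace I x →ₗ[ℝ] ℝ))
      - 2 * K * (g.gradSq (ℓ t) x * Real.exp (-ℓ t x))
      - 2 / (finrank ℝ E : ℝ) * (g.dalembertian (ℓ t) x) ^ 2 * Real.exp (-ℓ t x) := by
  have hslice : ∀ s ∈ S, ContMDiff I 𝓘(ℝ, ℝ) ∞ (ℓ s) := fun s hs ↦
    hℓ.comp_contMDiff (contMDiff_id.prodMk contMDiff_const) fun y ↦ ⟨mem_univ _, hs⟩
  have hℓt : ContMDiff I 𝓘(ℝ, ℝ) ∞ (ℓ t) := hslice t ht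
  -- time derivatives within `S` at `t`
  have hfd : HasDerivWithinAt (fun s ↦ ℓ s x) (derivWithin (fun s ↦ ℓ s x) S t) S t :=
    hasDerivWithinAt_time_of_contMDiffOn (by simp) hℓ x ht
  have hqfam := contMDiffOn_gradSq_family g hS hℓ
  have hqd : HasDerivWithinAt (fun s ↦ g.gradSq (ℓ s) x)
      (derivWithin (fun s ↦ g.gradSq (ℓ s) x) S t) S t :=
    hasDerivWithinAt_time_of_contMDiffOn (by simp) hqfam x ht
  have hprod : derivWithin (fun s ↦ g.gradSq (ℓ s) x * Real.exp (-ℓ s x)) S t =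
      derivWithin (fun s ↦ g.gradSq (ℓ s) x) S t * Real.exp (-ℓ t x)
        + g.gradSq (ℓ t) x * (Real.exp (-ℓ t x) * -(derivWithin (fun s ↦ ℓ s x) S t)) := by
    have hu : HasDerivWithinAt (fun s ↦ Real.exp (-ℓ s x))
        (Real.exp (-ℓ t x) * -(derivWithin (fun s ↦ ℓ s x) S t)) S t := (hfd.neg).exp
    exact (hqd.mul hu).derivWithin (hS t ht)
  -- the dimensional Bochner inequality and the product rule for `L`
  have hpt := fisher_pointwise_le_dim g hR hV hRic hS hS' hℓ heq x ht
  have hL := weightedLaplacian_gradSq_mul_exp_neg g (V := V) hℓt x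
  rw [hprod, heq t ht x, hL]
  have hB : 0 ≤ Real.exp (-ℓ t x) := (Real.exp_pos _).le
  nlinarith [mul_le_mul_of_nonneg_right hpt hB]

end PointwiseDensity


/-! ### Green's identities against a compactly supported cut-off, and the symmetry of `L` -/

section CutoffGreen

variable {n : ℕ} {M : Type uM} [TopologicalSpace M] [T2Space M] [SecondCountableTopology M]
  [ChartedSpace (EuclideanSpace ℝ (Fin n)) M] [IsManifold (𝓡 n) ∞ M]
  [T3Space M] [MeasurableSpace M] [BorelSpace M]
  {g : PseudoRiemannianMetric (𝓡 n) ∞ (EuclideanSpace ℝ (Fin n)) (TangentSpace (𝓡 n) : M → Type _)}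
  [g.HasLeviCivita]

omit [T2Space M] [SecondCountableTopology M] [T3Space M] [MeasurableSpace M] [BorelSpace M]
  [g.HasLeviCivita] in
/-- `d(a e^{-V})` paired with `db`: `g⁻¹(d(a e^{-V}), db) = e^{-V} g⁻¹(da, db) − a e^{-V} g⁻¹(dV, db)`.
[folklore] -/
theorem innerDual_mvfderiv_mul_exp_neg {a b V : M → ℝ} {x : M}
    (ha : MDifferentiableAt (𝓡 n) 𝓘(ℝ, ℝ) a x) (hV : MDifferentiableAt (𝓡 n) 𝓘(ℝ, ℝ) V x) :
    g.innerDual x (mvfderiv (𝓡 n) (fun y ↦ a y * Real.exp (-V y)) x :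
        TangentSpace (𝓡 n) x →ₗ[ℝ] ℝ) (mvfderiv (𝓡 n) b x : TangentSpace (𝓡 n) x →ₗ[ℝ] ℝ) =
      Real.exp (-V x) * g.innerDual x (mvfderiv (𝓡 n) a x : TangentSpace (𝓡 n) x →ₗ[ℝ] ℝ)
          (mvfderiv (𝓡 n) b x : TangentSpace (𝓡 n) x →ₗ[ℝ] ℝ)
        - a x * Real.exp (-V x) * g.innerDual x (mvfderiv (𝓡 n) V x : TangentSpace (𝓡 n) x →ₗ[ℝ] ℝ)
          (mvfderiv (𝓡 n) b x : TangentSpace (𝓡 n) x →ₗ[ℝ] ℝ) := by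
  rw [mvfderiv_mul_exp_neg_toLinearMap ha hV, g.innerDual_sub_left, g.innerDual_smul_left,
    g.innerDual_smul_left]

omit [T2Space M] [SecondCountableTopology M] [T3Space M] [MeasurableSpace M]
  [BorelSpace M] [g.HasLeviCivita] in
/-- `g⁻¹(dχ, db)` vanishes off the topological support of `χ`. [folklore] -/
theorem innerDual_mvfderiv_eq_zero_of_notMem_tsupport {χ b : M → ℝ} {x : M}
    (hx : x ∉ tsupport χ) :
    g.innerDual x (mvfderiv (𝓡 n) χ x : TangentSpace (𝓡 n) x →ₗ[ℝ] ℝ)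
      (mvfderiv (𝓡 n) b x : TangentSpace (𝓡 n) x →ₗ[ℝ] ℝ) = 0 := by
  rw [mvfderiv_eq_zero_of_notMem_tsupport hx]
  simp [PseudoRiemannianMetric.innerDual]

/-- **Green's identity for the weighted Laplacian against a compactly supported `C¹` cut-off**:
`∫ χ (Lb) e^{-V} dV_g = −∫ g⁻¹(dχ, db) e^{-V} dV_g` for `χ ∈ C¹_c`, `b ∈ C²`, `V ∈ C¹`
(Green's first identity with compact support, `GreenIdentityCompactSupport.lean`, for the test
function `χ e^{-V}`). [cite: BakryGentilLedoux2014, §3.2, proof of Prop. 3.2.1 (p. 141)] -/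
theorem integral_cutoff_mul_weightedLaplacian (hg : g.IsRiemannian) {χ b V : M → ℝ}
    (hχ : ContMDiff (𝓡 n) 𝓘(ℝ, ℝ) 1 χ) (hχc : HasCompactSupport χ)
    (hb : ContMDiff (𝓡 n) 𝓘(ℝ, ℝ) 2 b) (hV : ContMDiff (𝓡 n) 𝓘(ℝ, ℝ) 1 V) :
    ∫ x, χ x * (g.dalembertian b x
        - g.innerDual x (mvfderiv (𝓡 n) V x : TangentSpace (𝓡 n) x →ₗ[ℝ] ℝ)
            (mvfderiv (𝓡 n) b x : TangentSpace (𝓡 n) x →ₗ[ℝ] ℝ)) * Real.exp (-V x) ∂g.riemVolume =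
      -∫ x, g.innerDual x (mvfderiv (𝓡 n) χ x : TangentSpace (𝓡 n) x →ₗ[ℝ] ℝ)
          (mvfderiv (𝓡 n) b x : TangentSpace (𝓡 n) x →ₗ[ℝ] ℝ) * Real.exp (-V x) ∂g.riemVolume := by
  haveI : LocallyCompactSpace M := Manifold.locallyCompact_of_finiteDimensional (𝓡 n)
  haveI : SigmaCompactSpace M := sigmaCompactSpace_of_locallyCompact_secondCountable
  haveI := isFiniteMeasureOnCompacts_riemVolume (g := g) hg
  have hb1 : ContMDiff (𝓡 n) 𝓘(ℝ, ℝ) 1 b := hb.of_le (by norm_num)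
  have hw1 : ContMDiff (𝓡 n) 𝓘(ℝ, ℝ) 1 (fun x ↦ Real.exp (-V x)) :=
    ((Real.contDiff_exp.comp contDiff_neg).of_le le_top).comp_contMDiff hV
  set w : M → ℝ := fun x ↦ Real.exp (-V x) with hwdef
  have hwc : Continuous w := Real.continuous_exp.comp hV.continuous.neg
  set GVb : M → ℝ := fun x ↦ g.innerDual x (mvfderiv (𝓡 n) V x : TangentSpace (𝓡 n) x →ₗ[ℝ] ℝ)
      (mvfderiv (𝓡 n) b x : TangentSpace (𝓡 n) x →ₗ[ℝ] ℝ) with hGVbdef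
  set Gχb : M → ℝ := fun x ↦ g.innerDual x (mvfderiv (𝓡 n) χ x : TangentSpace (𝓡 n) x →ₗ[ℝ] ℝ)
      (mvfderiv (𝓡 n) b x : TangentSpace (𝓡 n) x →ₗ[ℝ] ℝ) with hGχbdef
  have hΔc : Continuous (g.dalembertian b) := continuous_dalembertian g hb
  have hGVbc : Continuous GVb := continuous_innerDual_mvfderiv g hV hb1
  have hGχbc : Continuous Gχb := continuous_innerDual_mvfderiv g hχ hb1
  have hχcont : Continuous χ := hχ.continuous
  -- Green's first identity for the compactly supported `χ e^{-V}`
  have hu : ContMDiff (𝓡 n) 𝓘(ℝ, ℝ) 1 (fun x ↦ χ x * Real.exp (-V x)) := hχ.mul hw1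
  have huc : HasCompactSupport (fun x ↦ χ x * Real.exp (-V x)) := hχc.mul_right
  have h1 : ∫ x, (χ x * Real.exp (-V x)) * g.dalembertian b x ∂g.riemVolume =
      -∫ x, g.innerDual x (mvfderiv (𝓡 n) (fun x ↦ χ x * Real.exp (-V x)) x :
          TangentSpace (𝓡 n) x →ₗ[ℝ] ℝ) (mvfderiv (𝓡 n) b x : TangentSpace (𝓡 n) x →ₗ[ℝ] ℝ)
        ∂g.riemVolume := by
    haveI := (PseudoRiemannianMetric.ofRiemannian (g.toContMDiffRiemannianMetric hg)).hasLeviCivita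
    have h := integral_mul_dalembertian_eq_neg_integral_innerDual_of_hasCompactSupport
      (g.toContMDiffRiemannianMetric hg) hu huc hb
    rw [PseudoRiemannianMetric.riemVolume_eq hg]
    exact h
  have hpt : ∀ x, g.innerDual x (mvfderiv (𝓡 n) (fun x ↦ χ x * Real.exp (-V x)) x :
      TangentSpace (𝓡 n) x →ₗ[ℝ] ℝ) (mvfderiv (𝓡 n) b x : TangentSpace (𝓡 n) x →ₗ[ℝ] ℝ) =
      Gχb x * w x - χ x * GVb x * w x := by
    intro x
    rw [innerDual_mvfderiv_mul_exp_neg (hχ.mdifferentiableAt one_ne_zero)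
      (hV.mdifferentiableAt one_ne_zero)]
    simp only [hGχbdef, hGVbdef, hwdef]
    ring
  -- integrability (compact supports)
  have hGχbs : HasCompactSupport Gχb :=
    HasCompactSupport.intro' hχc (isClosed_tsupport _) fun x hx ↦
      innerDual_mvfderiv_eq_zero_of_notMem_tsupport hx
  have iΔ : Integrable (fun x ↦ (χ x * Real.exp (-V x)) * g.dalembertian b x) g.riemVolume :=
    ((hχcont.mul hwc).mul hΔc).integrable_of_hasCompactSupport huc.mul_right
  have iGV : Integrable (fun x ↦ χ x * GVb x * w x) g.riemVolume :=
    ((hχcont.mul hGVbc).mul hwc).integrable_of_hasCompactSupport (hχc.mul_right).mul_right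
  have iGχ : Integrable (fun x ↦ Gχb x * w x) g.riemVolume :=
    (hGχbc.mul hwc).integrable_of_hasCompactSupport hGχbs.mul_right
  -- assemble
  have s1 : ∫ x, χ x * (g.dalembertian b x - GVb x) * Real.exp (-V x) ∂g.riemVolume =
      ∫ x, ((χ x * Real.exp (-V x)) * g.dalembertian b x - χ x * GVb x * w x) ∂g.riemVolume :=
    integral_congr_ae (Eventually.of_forall fun x ↦ by simp only [hwdef]; ring)
  have s3 : ∫ x, g.innerDual x (mvfderiv (𝓡 n) (fun x ↦ χ x * Real.exp (-V x)) x :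
      TangentSpace (𝓡 n) x →ₗ[ℝ] ℝ) (mvfderiv (𝓡 n) b x : TangentSpace (𝓡 n) x →ₗ[ℝ] ℝ)
        ∂g.riemVolume = ∫ x, (Gχb x * w x - χ x * GVb x * w x) ∂g.riemVolume :=
    integral_congr_ae (Eventually.of_forall hpt)
  rw [s1, integral_sub iΔ iGV, h1, s3, integral_sub iGχ iGV]
  ring

/-- **Green's identity with the compactly supported factor under the Laplacian**:
`∫ a (Lχ) e^{-V} dV_g = −∫ g⁻¹(da, dχ) e^{-V} dV_g` for `a ∈ C¹`, `χ ∈ C²_c`, `V ∈ C¹`.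
[cite: BakryGentilLedoux2014, §3.2, proof of Prop. 3.2.1 (p. 141)] -/
theorem integral_mul_weightedLaplacian_cutoff (hg : g.IsRiemannian) {χ a V : M → ℝ}
    (ha : ContMDiff (𝓡 n) 𝓘(ℝ, ℝ) 1 a) (hχ : ContMDiff (𝓡 n) 𝓘(ℝ, ℝ) 2 χ) (hχc : HasCompactSupport χ)
    (hV : ContMDiff (𝓡 n) 𝓘(ℝ, ℝ) 1 V) :
    ∫ x, a x * (g.dalembertian χ x
        - g.innerDual x (mvfderiv (𝓡 n) V x : TangentSpace (𝓡 n) x →ₗ[ℝ] ℝ)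
            (mvfderiv (𝓡 n) χ x : TangentSpace (𝓡 n) x →ₗ[ℝ] ℝ)) * Real.exp (-V x) ∂g.riemVolume =
      -∫ x, g.innerDual x (mvfderiv (𝓡 n) a x : TangentSpace (𝓡 n) x →ₗ[ℝ] ℝ)
          (mvfderiv (𝓡 n) χ x : TangentSpace (𝓡 n) x →ₗ[ℝ] ℝ) * Real.exp (-V x) ∂g.riemVolume := by
  haveI : LocallyCompactSpace M := Manifold.locallyCompact_of_finiteDimensional (𝓡 n)
  haveI : SigmaCompactSpace M := sigmaCompactSpace_of_locallyCompact_secondCountable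
  haveI := isFiniteMeasureOnCompacts_riemVolume (g := g) hg
  have hχ1 : ContMDiff (𝓡 n) 𝓘(ℝ, ℝ) 1 χ := hχ.of_le (by norm_num)
  have hw1 : ContMDiff (𝓡 n) 𝓘(ℝ, ℝ) 1 (fun x ↦ Real.exp (-V x)) :=
    ((Real.contDiff_exp.comp contDiff_neg).of_le le_top).comp_contMDiff hV
  set w : M → ℝ := fun x ↦ Real.exp (-V x) with hwdef
  have hwc : Continuous w := Real.continuous_exp.comp hV.continuous.neg
  set GVχ : M → ℝ := fun x ↦ g.innerDual x (mvfderiv (𝓡 n) V x : TangentSpace (𝓡 n) x →ₗ[ℝ] ℝ)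
      (mvfderiv (𝓡 n) χ x : TangentSpace (𝓡 n) x →ₗ[ℝ] ℝ) with hGVχdef
  set Gaχ : M → ℝ := fun x ↦ g.innerDual x (mvfderiv (𝓡 n) a x : TangentSpace (𝓡 n) x →ₗ[ℝ] ℝ)
      (mvfderiv (𝓡 n) χ x : TangentSpace (𝓡 n) x →ₗ[ℝ] ℝ) with hGaχdef
  have hΔc : Continuous (g.dalembertian χ) := continuous_dalembertian g hχ
  have hGVχc : Continuous GVχ := continuous_innerDual_mvfderiv g hV hχ1
  have hGaχc : Continuous Gaχ := continuous_innerDual_mvfderiv g ha hχ1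
  have hac : Continuous a := ha.continuous
  -- supports
  have hΔs : HasCompactSupport (g.dalembertian χ) :=
    HasCompactSupport.intro' hχc (isClosed_tsupport _) fun x hx ↦
      g.dalembertian_eq_zero_of_notMem_tsupport hx
  have hGVχs : HasCompactSupport GVχ :=
    HasCompactSupport.intro' hχc (isClosed_tsupport _) fun x hx ↦ by
      simp only [hGVχdef]
      rw [g.innerDual_comm]
      exact innerDual_mvfderiv_eq_zero_of_notMem_tsupport hx
  have hGaχs : HasCompactSupport Gaχ :=
    HasCompactSupport.intro' hχc (isClosed_tsupport _) fun x hx ↦ by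
      simp only [hGaχdef]
      rw [g.innerDual_comm]
      exact innerDual_mvfderiv_eq_zero_of_notMem_tsupport hx
  -- Green's first identity with the compactly supported factor on the right
  have hu : ContMDiff (𝓡 n) 𝓘(ℝ, ℝ) 1 (fun x ↦ a x * Real.exp (-V x)) := ha.mul hw1
  have h1 : ∫ x, (a x * Real.exp (-V x)) * g.dalembertian χ x ∂g.riemVolume =
      -∫ x, g.innerDual x (mvfderiv (𝓡 n) (fun x ↦ a x * Real.exp (-V x)) x :
          TangentSpace (𝓡 n) x →ₗ[ℝ] ℝ) (mvfderiv (𝓡 n) χ x : TangentSpace (𝓡 n) x →ₗ[ℝ] ℝ)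
        ∂g.riemVolume := by
    haveI := (PseudoRiemannianMetric.ofRiemannian (g.toContMDiffRiemannianMetric hg)).hasLeviCivita
    have h := integral_mul_dalembertian_eq_neg_integral_innerDual_of_hasCompactSupport_right
      (g.toContMDiffRiemannianMetric hg) hu hχ hχc
    rw [PseudoRiemannianMetric.riemVolume_eq hg]
    exact h
  have hpt : ∀ x, g.innerDual x (mvfderiv (𝓡 n) (fun x ↦ a x * Real.exp (-V x)) x :
      TangentSpace (𝓡 n) x →ₗ[ℝ] ℝ) (mvfderiv (𝓡 n) χ x : TangentSpace (𝓡 n) x →ₗ[ℝ] ℝ) =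
      Gaχ x * w x - a x * GVχ x * w x := by
    intro x
    rw [innerDual_mvfderiv_mul_exp_neg (ha.mdifferentiableAt one_ne_zero)
      (hV.mdifferentiableAt one_ne_zero)]
    simp only [hGaχdef, hGVχdef, hwdef]
    ring
  -- integrability
  have iΔ : Integrable (fun x ↦ (a x * Real.exp (-V x)) * g.dalembertian χ x) g.riemVolume :=
    ((hac.mul hwc).mul hΔc).integrable_of_hasCompactSupport hΔs.mul_left
  have iGV : Integrable (fun x ↦ a x * GVχ x * w x) g.riemVolume :=
    ((hac.mul hGVχc).mul hwc).integrable_of_hasCompactSupport (hGVχs.mul_left).mul_right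
  have iGa : Integrable (fun x ↦ Gaχ x * w x) g.riemVolume :=
    (hGaχc.mul hwc).integrable_of_hasCompactSupport hGaχs.mul_right
  have s1 : ∫ x, a x * (g.dalembertian χ x - GVχ x) * Real.exp (-V x) ∂g.riemVolume =
      ∫ x, ((a x * Real.exp (-V x)) * g.dalembertian χ x - a x * GVχ x * w x) ∂g.riemVolume :=
    integral_congr_ae (Eventually.of_forall fun x ↦ by simp only [hwdef]; ring)
  have s3 : ∫ x, g.innerDual x (mvfderiv (𝓡 n) (fun x ↦ a x * Real.exp (-V x)) x :
      TangentSpace (𝓡 n) x →ₗ[ℝ] ℝ) (mvfderiv (𝓡 n) χ x : TangentSpace (𝓡 n) x →ₗ[ℝ] ℝ)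
        ∂g.riemVolume = ∫ x, (Gaχ x * w x - a x * GVχ x * w x) ∂g.riemVolume :=
    integral_congr_ae (Eventually.of_forall hpt)
  rw [s1, integral_sub iΔ iGV, h1, s3, integral_sub iGa iGV]
  ring

/-- **Symmetry of `L` against a compactly supported cut-off**: `∫ χ (LQ) e^{-V} = ∫ Q (Lχ) e^{-V}`
for `χ ∈ C²_c`, `Q ∈ C²`, `V ∈ C¹` (both sides equal `−∫ g⁻¹(dχ, dQ) e^{-V}`) — Li–Wang's
"integration by parts, `∫ (Δ_f u) φ̄ʳ dv₀ = ∫ u (Δ_f φ̄ʳ) dv₀`" (proof of Lemma 5.6), here for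
any `C²` function `u`. [cite: LiWang2020, Lemma 5.6 (arXiv p. 18)] -/
theorem integral_cutoff_mul_weightedLaplacian_symm (hg : g.IsRiemannian) {χ Q V : M → ℝ}
    (hχ : ContMDiff (𝓡 n) 𝓘(ℝ, ℝ) 2 χ) (hχc : HasCompactSupport χ)
    (hQ : ContMDiff (𝓡 n) 𝓘(ℝ, ℝ) 2 Q) (hV : ContMDiff (𝓡 n) 𝓘(ℝ, ℝ) 1 V) :
    ∫ x, χ x * (g.dalembertian Q x
        - g.innerDual x (mvfderiv (𝓡 n) V x : TangentSpace (𝓡 n) x →ₗ[ℝ] ℝ)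
            (mvfderiv (𝓡 n) Q x : TangentSpace (𝓡 n) x →ₗ[ℝ] ℝ)) * Real.exp (-V x) ∂g.riemVolume =
      ∫ x, Q x * (g.dalembertian χ x
        - g.innerDual x (mvfderiv (𝓡 n) V x : TangentSpace (𝓡 n) x →ₗ[ℝ] ℝ)
            (mvfderiv (𝓡 n) χ x : TangentSpace (𝓡 n) x →ₗ[ℝ] ℝ)) * Real.exp (-V x) ∂g.riemVolume := by
  rw [integral_cutoff_mul_weightedLaplacian hg (hχ.of_le (by norm_num)) hχc hQ hV,
    integral_mul_weightedLaplacian_cutoff hg (hQ.of_le (by norm_num)) hχ hχc hV]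
  congr 1
  refine integral_congr_ae (Eventually.of_forall fun x ↦ ?_)
  dsimp only
  rw [g.innerDual_comm]

end CutoffGreen


/-! ### The Leibniz rule and continuity for integrals against a compactly supported cut-off -/

section CutoffLeibniz

variable {n : ℕ} {M : Type uM} [TopologicalSpace M] [T2Space M] [SecondCountableTopology M]
  [ChartedSpace (EuclideanSpace ℝ (Fin n)) M] [IsManifold (𝓡 n) ∞ M]
  [T3Space M] [MeasurableSpace M] [BorelSpace M]
  {g : PseudoRiemannianMetric (𝓡 n) ∞ (EuclideanSpace ℝ (Fin n)) (TangentSpace (𝓡 n) : M → Type _)}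
  [g.HasLeviCivita]

omit [T2Space M] [SecondCountableTopology M] [g.HasLeviCivita] in
/-- **The Leibniz rule `d/dt ∫ χ G(t, ·) w = ∫ χ ∂ₜG(t, ·) w` for a compactly supported continuous
cut-off `χ`**, `G` smooth on `M × [0, ∞)`, `w` continuous, at every `t > 0` (differentiation under
the integral sign; the derivative is bounded on `tsupport χ × [t/2, 3t/2]` by continuity, and the
Riemannian measure is finite on compact sets). [folklore] -/
theorem hasDerivAt_integral_cutoff (hg : g.IsRiemannian) {G : ℝ → M → ℝ}
    (hG : ContMDiffOn ((𝓡 n).prod 𝓘(ℝ, ℝ)) 𝓘(ℝ, ℝ) ∞ (fun p : M × ℝ ↦ G p.2 p.1) (univ ×ˢ Ici 0))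
    {χ w : M → ℝ} (hχ : Continuous χ) (hχc : HasCompactSupport χ) (hw : Continuous w)
    {t : ℝ} (ht : 0 < t) :
    HasDerivAt (fun s ↦ ∫ y, χ y * G s y * w y ∂g.riemVolume)
      (∫ y, χ y * derivWithin (fun s ↦ G s y) (Ici 0) t * w y ∂g.riemVolume) t := by
  haveI := isFiniteMeasureOnCompacts_riemVolume (g := g) hg
  have hS : UniqueDiffOn ℝ (Ici (0 : ℝ)) := uniqueDiffOn_Ici 0
  set G' : ℝ → M → ℝ := fun s y ↦ derivWithin (fun r ↦ G r y) (Ici 0) s with hG'def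
  have hG'fam := contMDiffOn_derivWithin_time_of_uniqueDiffOn (u := G) hS hG
  have hGc : ContinuousOn (fun z : M × ℝ ↦ G z.2 z.1) (univ ×ˢ Ici 0) := hG.continuousOn
  have hG'c : ContinuousOn (fun z : M × ℝ ↦ G' z.2 z.1) (univ ×ˢ Ici 0) := hG'fam.continuousOn
  have hGs : ∀ s ∈ Ici (0 : ℝ), Continuous fun y ↦ G s y := fun s hs ↦
    continuous_slice_of_continuousOn_prod hGc hs
  have hG's : ∀ s ∈ Ici (0 : ℝ), Continuous fun y ↦ G' s y := fun s hs ↦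
    continuous_slice_of_continuousOn_prod hG'c hs
  -- the compact set `tsupport χ × [t/2, 3t/2]` and a bound for `χ G' w` on it
  set K : Set M := tsupport χ with hKdef
  have hK : IsCompact K := hχc
  set J : Set ℝ := Icc (t / 2) (3 * t / 2) with hJdef
  have hJS : J ⊆ Ici 0 := fun s hs ↦ by
    simp only [hJdef, mem_Icc] at hs; exact le_trans (by linarith) hs.1
  have hKJ : IsCompact (K ×ˢ J) := hK.prod isCompact_Icc
  have hcont : ContinuousOn (fun z : M × ℝ ↦ χ z.1 * G' z.2 z.1 * w z.1) (K ×ˢ J) :=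
    (((hχ.comp continuous_fst).continuousOn).mul
      (hG'c.mono (prod_mono (subset_univ _) hJS))).mul (hw.comp continuous_fst).continuousOn
  obtain ⟨D, hD⟩ := hKJ.exists_bound_of_continuousOn hcont
  set bound : M → ℝ := K.indicator (fun _ ↦ |D|) with hbdef
  have hKm : MeasurableSet K := (isClosed_tsupport χ).measurableSet
  have hbI : Integrable bound g.riemVolume :=
    (integrableOn_const (hK.measure_lt_top).ne).integrable_indicator hKm
  have hJn : J ∈ 𝓝 t := Icc_mem_nhds (by linarith) (by linarith)
  have hmain := hasDerivAt_integral_of_dominated_loc_of_deriv_le (μ := g.riemVolume)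
    (F := fun s y ↦ χ y * G s y * w y) (F' := fun s y ↦ χ y * G' s y * w y) (x₀ := t) (s := J)
    (bound := bound) hJn ?_ ?_ ?_ ?_ hbI ?_
  · exact hmain.2
  · filter_upwards [Ioi_mem_nhds ht] with s hs
    exact ((hχ.mul (hGs s (show s ∈ Ici (0 : ℝ) from le_of_lt (mem_Ioi.1 hs)))).mul
      hw).aestronglyMeasurable
  · exact ((hχ.mul (hGs t ht.le)).mul hw).integrable_of_hasCompactSupport
      ((hχc.mul_right).mul_right)
  · exact ((hχ.mul (hG's t ht.le)).mul hw).aestronglyMeasurable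
  · refine Eventually.of_forall fun y s hs ↦ ?_
    by_cases hy : y ∈ K
    · have h := hD (y, s) ⟨hy, hs⟩
      simp only [hbdef, indicator_of_mem hy]
      exact h.trans (le_abs_self D)
    · have h0 : χ y = 0 := image_eq_zero_of_notMem_tsupport hy
      simp only [h0, zero_mul, norm_zero, hbdef, indicator_of_notMem hy, le_refl]
  · refine Eventually.of_forall fun y s hs ↦ ?_
    have hs0 : 0 < s := by simp only [hJdef, mem_Icc] at hs; linarith [hs.1]
    have hd : HasDerivAt (fun r ↦ G r y) (G' s y) s :=
      (hasDerivWithinAt_time_of_contMDiffOn (k := ∞) (by simp) hG y hs0.le).hasDerivAt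
        (Ici_mem_nhds hs0)
    exact (hd.const_mul (χ y)).mul_const (w y)

omit [T2Space M] [SecondCountableTopology M] [g.HasLeviCivita] in
/-- **Continuity on `[0, ∞)` of `t ↦ ∫ χ G(t, ·) w`** for a compactly supported continuous cut-off
`χ`, `G` jointly continuous on `M × [0, ∞)`, `w` continuous (dominated convergence with a bound on
`tsupport χ × [0, t₀ + 1]`). [folklore] -/
theorem continuousOn_integral_cutoff (hg : g.IsRiemannian) {G : ℝ → M → ℝ}
    (hG : ContinuousOn (fun z : M × ℝ ↦ G z.2 z.1) (univ ×ˢ Ici 0))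
    {χ w : M → ℝ} (hχ : Continuous χ) (hχc : HasCompactSupport χ) (hw : Continuous w) :
    ContinuousOn (fun s ↦ ∫ y, χ y * G s y * w y ∂g.riemVolume) (Ici 0) := by
  haveI := isFiniteMeasureOnCompacts_riemVolume (g := g) hg
  intro t₀ ht₀
  have hGs : ∀ s ∈ Ici (0 : ℝ), Continuous fun y ↦ G s y := fun s hs ↦
    continuous_slice_of_continuousOn_prod hG hs
  set K : Set M := tsupport χ with hKdef
  have hK : IsCompact K := hχc
  set J : Set ℝ := Icc 0 (t₀ + 1) with hJdef
  have hJS : J ⊆ Ici 0 := fun s hs ↦ hs.1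
  have hKJ : IsCompact (K ×ˢ J) := hK.prod isCompact_Icc
  have hcont : ContinuousOn (fun z : M × ℝ ↦ χ z.1 * G z.2 z.1 * w z.1) (K ×ˢ J) :=
    (((hχ.comp continuous_fst).continuousOn).mul
      (hG.mono (prod_mono (subset_univ _) hJS))).mul (hw.comp continuous_fst).continuousOn
  obtain ⟨D, hD⟩ := hKJ.exists_bound_of_continuousOn hcont
  set bound : M → ℝ := K.indicator (fun _ ↦ |D|) with hbdef
  have hKm : MeasurableSet K := (isClosed_tsupport χ).measurableSet
  have hbI : Integrable bound g.riemVolume :=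
    (integrableOn_const (hK.measure_lt_top).ne).integrable_indicator hKm
  have hnhds : J ∈ 𝓝[Ici 0] t₀ := by
    have h1 : Ici 0 ∩ Iio (t₀ + 1) ⊆ J := fun s hs ↦ ⟨hs.1, le_of_lt hs.2⟩
    exact mem_of_superset (inter_mem_nhdsWithin (Ici 0)
      (Iio_mem_nhds (show t₀ < t₀ + 1 by linarith))) h1
  refine continuousWithinAt_of_dominated (bound := bound) ?_ ?_ hbI ?_
  · filter_upwards [self_mem_nhdsWithin] with s hs
    exact ((hχ.mul (hGs s hs)).mul hw).aestronglyMeasurable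
  · filter_upwards [hnhds] with s hs
    refine Eventually.of_forall fun y ↦ ?_
    by_cases hy : y ∈ K
    · have h := hD (y, s) ⟨hy, hs⟩
      simp only [hbdef, indicator_of_mem hy]
      exact h.trans (le_abs_self D)
    · have h0 : χ y = 0 := image_eq_zero_of_notMem_tsupport hy
      simp only [h0, zero_mul, norm_zero, hbdef, indicator_of_notMem hy, le_refl]
  · refine Eventually.of_forall fun y ↦ ?_
    have hc : ContinuousWithinAt (fun z : M × ℝ ↦ G z.2 z.1) (univ ×ˢ Ici 0) (y, t₀) :=
      hG (y, t₀) ⟨mem_univ _, ht₀⟩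
    have hι : ContinuousWithinAt (fun s : ℝ ↦ ((y, s) : M × ℝ)) (Ici 0) t₀ :=
      (continuous_const.prodMk continuous_id).continuousWithinAt
    have hGy : ContinuousWithinAt (fun s ↦ G s y) (Ici 0) t₀ := hc.comp hι fun s hs ↦ ⟨mem_univ _, hs⟩
    exact (continuousWithinAt_const.mul hGy).mul continuousWithinAt_const

end CutoffLeibniz

/-! ### A cut-off profile with two bounded derivatives -/

section Profile

/-- A smooth cut-off profile on `ℝ` equal to `1` on `(−∞, 1]`, to `0` on `[2, ∞)`, with values in
`[0, 1]`, whose first two derivatives are bounded and vanish on `(−∞, 1)` (Li–Wang's `η`).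
[cite: LiWang2020, §5, definition of `φ̄ʳ = η(f/r)` (arXiv p. 18)] -/
theorem exists_cutoffProfile₂ :
    ∃ φ : ℝ → ℝ, ContDiff ℝ ∞ φ ∧ (∀ t ≤ 1, φ t = 1) ∧ (∀ t, 2 ≤ t → φ t = 0) ∧
      (∀ t, 0 ≤ φ t ∧ φ t ≤ 1) ∧ (∀ t < 1, deriv φ t = 0 ∧ deriv (deriv φ) t = 0) ∧
      ∃ C : ℝ, 0 ≤ C ∧ (∀ t, |deriv φ t| ≤ C) ∧ ∀ t, |deriv (deriv φ) t| ≤ C := by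
  set φ : ℝ → ℝ := fun t ↦ 1 - Real.smoothTransition (t - 1) with hφ
  have hφs : ContDiff ℝ ∞ φ :=
    contDiff_const.sub (Real.smoothTransition.contDiff.comp (contDiff_id.sub contDiff_const))
  have hφ's : ContDiff ℝ ∞ (deriv φ) := (contDiff_infty_iff_deriv.1 hφs).2
  -- `φ` is locally constant off `[1, 2]`, so both derivatives vanish there
  have hlow : ∀ t < 1, φ =ᶠ[𝓝 t] fun _ ↦ (1 : ℝ) := fun t ht ↦ by
    filter_upwards [Iio_mem_nhds ht] with s hs
    simp [hφ, Real.smoothTransition.zero_of_nonpos (by linarith [mem_Iio.1 hs] : s - 1 ≤ 0)]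
  have hhigh : ∀ t, 2 < t → φ =ᶠ[𝓝 t] fun _ ↦ (0 : ℝ) := fun t ht ↦ by
    filter_upwards [Ioi_mem_nhds ht] with s hs
    simp [hφ, Real.smoothTransition.one_of_one_le (by linarith [mem_Ioi.1 hs] : 1 ≤ s - 1)]
  have hd_low : ∀ t < 1, deriv φ t = 0 ∧ deriv (deriv φ) t = 0 := fun t ht ↦ by
    have h1 : deriv φ =ᶠ[𝓝 t] fun _ ↦ (0 : ℝ) := by
      have h := (hlow t ht).deriv
      simp only [deriv_const'] at h
      exact h
    refine ⟨?_, ?_⟩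
    · have := h1.self_of_nhds; simpa using this
    · rw [h1.deriv_eq]; simp
  have hd_high : ∀ t, 2 < t → deriv φ t = 0 ∧ deriv (deriv φ) t = 0 := fun t ht ↦ by
    have h1 : deriv φ =ᶠ[𝓝 t] fun _ ↦ (0 : ℝ) := by
      have h := (hhigh t ht).deriv
      simp only [deriv_const'] at h
      exact h
    refine ⟨?_, ?_⟩
    · have := h1.self_of_nhds; simpa using this
    · rw [h1.deriv_eq]; simp
  -- compact supports of the two derivatives
  have hsupp1 : HasCompactSupport (deriv φ) := by
    refine HasCompactSupport.intro (K := Icc (1 : ℝ) 2) isCompact_Icc fun t ht ↦ ?_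
    rw [mem_Icc, not_and_or, not_le, not_le] at ht
    rcases ht with ht | ht
    · exact (hd_low t ht).1
    · exact (hd_high t ht).1
  have hsupp2 : HasCompactSupport (deriv (deriv φ)) := by
    refine HasCompactSupport.intro (K := Icc (1 : ℝ) 2) isCompact_Icc fun t ht ↦ ?_
    rw [mem_Icc, not_and_or, not_le, not_le] at ht
    rcases ht with ht | ht
    · exact (hd_low t ht).2
    · exact (hd_high t ht).2
  have hc1 : Continuous (deriv φ) := hφs.continuous_deriv (by simp)
  have hc2 : Continuous (deriv (deriv φ)) := hφ's.continuous_deriv (by simp)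
  obtain ⟨C₁, hC₁⟩ := hc1.bounded_above_of_compact_support hsupp1
  obtain ⟨C₂, hC₂⟩ := hc2.bounded_above_of_compact_support hsupp2
  refine ⟨φ, hφs, ?_, ?_, ?_, hd_low, max (max C₁ C₂) 0, le_max_right _ _, fun t ↦ ?_, fun t ↦ ?_⟩
  · intro t ht
    simp [hφ, Real.smoothTransition.zero_of_nonpos (by linarith : t - 1 ≤ 0)]
  · intro t ht
    simp [hφ, Real.smoothTransition.one_of_one_le (by linarith : 1 ≤ t - 1)]
  · intro t
    exact ⟨sub_nonneg.2 (Real.smoothTransition.le_one _),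
      sub_le_self _ (Real.smoothTransition.nonneg _)⟩
  · have h := hC₁ t
    rw [Real.norm_eq_abs] at h
    exact h.trans ((le_max_left _ _).trans (le_max_left _ _))
  · have h := hC₂ t
    rw [Real.norm_eq_abs] at h
    exact h.trans ((le_max_right _ _).trans (le_max_left _ _))

end Profile

/-! ### Li–Wang's cut-offs `η(f/r)` on a shrinker: bounded weighted Laplacian -/

section ShrinkerCutoff

variable {n : ℕ} {M : Type uM} [TopologicalSpace M] [T2Space M]
  [ChartedSpace (EuclideanSpace ℝ (Fin n)) M] [IsManifold (𝓡 n) ∞ M]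
  {g : PseudoRiemannianMetric (𝓡 n) ∞ (EuclideanSpace ℝ (Fin n)) (TangentSpace (𝓡 n) : M → Type _)}
  [g.HasLeviCivita] {f : M → ℝ}

/-- **Li–Wang's cut-offs `φ̄ʳ = η(f/r)` on a gradient shrinker** (proof of Thm. 5.4, before Lemma 5.5):
on a shrinker `Ric + Hess f = g/2`, `R + |∇f|² = f` with `R ≥ 0` and proper `f`, and for a weight
with `dV = df`, the functions `χ_r = η(f/r)` (`r ≥ 1`) are smooth, compactly supported, with values
in `[0, 1]`, equal to `1` on `{f ≤ r}`, and their weighted Laplacians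
`Lχ_r = r⁻²η''(f/r)|∇f|² + r⁻¹η'(f/r)(n/2 − f)` are bounded uniformly in `r` and vanish on
`{f < r}` ("`Δ_f φ̄ʳ` is supported on `{f ≥ r}` and `|Δ_f φ̄ʳ| ≤ C`").
[cite: LiWang2020, §5, the cut-offs `φ̄ʳ` and the bound `|Δ_f φ̄ʳ| ≤ C` (arXiv p. 18)] -/
theorem exists_shrinkerCutoff (hg : g.IsRiemannian) (hf : ContMDiff (𝓡 n) 𝓘(ℝ, ℝ) ∞ f)
    (hsol : ∀ (x : M) (X Y : TangentSpace (𝓡 n) x),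
      g.ricci x X Y + g.hessian f x X Y = (1 / 2 : ℝ) * g.val x X Y)
    (hnorm : ∀ x : M, g.scalarCurvature x + g.gradSq f x = f x)
    (hS : ∀ x, 0 ≤ g.scalarCurvature x) (hprop : ∀ c : ℝ, IsCompact {x | f x ≤ c})
    {V : M → ℝ} (hdV : ∀ x, mvfderiv (𝓡 n) V x = mvfderiv (𝓡 n) f x) :
    ∃ C : ℝ, 0 ≤ C ∧ ∃ χ : ℝ → M → ℝ, ∀ r : ℝ, 1 ≤ r →
      ContMDiff (𝓡 n) 𝓘(ℝ, ℝ) ∞ (χ r) ∧ HasCompactSupport (χ r) ∧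
      (∀ x, 0 ≤ χ r x ∧ χ r x ≤ 1) ∧ (∀ x, f x ≤ r → χ r x = 1) ∧
      (∀ x, |g.dalembertian (χ r) x
          - g.innerDual x (mvfderiv (𝓡 n) V x : TangentSpace (𝓡 n) x →ₗ[ℝ] ℝ)
              (mvfderiv (𝓡 n) (χ r) x : TangentSpace (𝓡 n) x →ₗ[ℝ] ℝ)| ≤ C) ∧
      (∀ x, f x < r → g.dalembertian (χ r) x
          - g.innerDual x (mvfderiv (𝓡 n) V x : TangentSpace (𝓡 n) x →ₗ[ℝ] ℝ)
              (mvfderiv (𝓡 n) (χ r) x : TangentSpace (𝓡 n) x →ₗ[ℝ] ℝ) = 0) := by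
  obtain ⟨φ, hφs, hφ1, hφ0, hφ01, hφd0, Cφ, hCφ0, hCφ1, hCφ2⟩ := exists_cutoffProfile₂
  -- the soliton identities
  have hgradf : ∀ x, g.gradSq f x = f x - g.scalarCurvature x := fun x ↦ by linarith [hnorm x]
  have hΔf : ∀ x, g.dalembertian f x = n / 2 - g.scalarCurvature x := fun x ↦ by
    linarith [scalarCurvature_add_dalembertian hsol x]
  have hf0 : ∀ x, 0 ≤ f x := fun x ↦ by linarith [hnorm x, hS x, g.gradSq_nonneg hg f x]
  have hgradle : ∀ x, g.gradSq f x ≤ f x := fun x ↦ by linarith [hgradf x, hS x]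
  -- the rescaled profiles
  set ζ : ℝ → ℝ → ℝ := fun r t ↦ φ (t / r) with hζ
  have hζs : ∀ r, ContDiff ℝ ∞ (ζ r) := fun r ↦ hφs.comp (contDiff_id.div_const _)
  have hζd : ∀ r t, HasDerivAt (ζ r) (deriv φ (t / r) / r) t := fun r t ↦ by
    have h1 : HasDerivAt (fun s : ℝ ↦ s / r) (1 / r) t := (hasDerivAt_id t).div_const _
    have h2 : HasDerivAt φ (deriv φ (t / r)) (t / r) := (hφs.differentiable (by simp) _).hasDerivAt
    simpa [hζ, div_eq_mul_inv, Function.comp_def] using h2.comp t h1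
  have hζ' : ∀ r, deriv (ζ r) = fun t ↦ deriv φ (t / r) / r := fun r ↦ funext fun t ↦ (hζd r t).deriv
  have hζ'd : ∀ r t, HasDerivAt (deriv (ζ r)) (deriv (deriv φ) (t / r) / r / r) t := fun r t ↦ by
    rw [hζ' r]
    have h1 : HasDerivAt (fun s : ℝ ↦ s / r) (1 / r) t := (hasDerivAt_id t).div_const _
    have h2 : HasDerivAt (deriv φ) (deriv (deriv φ) (t / r)) (t / r) :=
      (((contDiff_infty_iff_deriv.1 hφs).2).differentiable (by simp) _).hasDerivAt
    have h3 := (h2.comp t h1).div_const r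
    simpa [div_eq_mul_inv, Function.comp_def] using h3
  have hζ'' : ∀ r t, deriv (deriv (ζ r)) t = deriv (deriv φ) (t / r) / r / r := fun r t ↦
    (hζ'd r t).deriv
  set χ : ℝ → M → ℝ := fun r x ↦ ζ r (f x) with hχ
  refine ⟨2 * Cφ + Cφ * (n / 2 + 2), by positivity, χ, fun r hr ↦ ?_⟩
  have hr0 : 0 < r := by linarith
  have hχs : ContMDiff (𝓡 n) 𝓘(ℝ, ℝ) ∞ (χ r) := (hζs r).comp_contMDiff hf
  -- the weighted Laplacian of `χ r`
  have hL : ∀ x, g.dalembertian (χ r) x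
      - g.innerDual x (mvfderiv (𝓡 n) V x : TangentSpace (𝓡 n) x →ₗ[ℝ] ℝ)
          (mvfderiv (𝓡 n) (χ r) x : TangentSpace (𝓡 n) x →ₗ[ℝ] ℝ) =
      deriv (deriv φ) (f x / r) / r / r * g.gradSq f x
        + deriv φ (f x / r) / r * (n / 2 - f x) := by
    intro x
    have hf2 : ContMDiffAt (𝓡 n) 𝓘(ℝ, ℝ) 2 f x := (hf.of_le (WithTop.coe_le_coe.mpr le_top)).contMDiffAt
    have hfd : MDifferentiableAt (𝓡 n) 𝓘(ℝ, ℝ) f x := hf.mdifferentiableAt (by simp)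
    have hζ2 : ContDiffAt ℝ 2 (ζ r) (f x) :=
      ((hζs r).of_le (WithTop.coe_le_coe.mpr le_top)).contDiffAt
    have hΔ := g.dalembertian_real_comp (ζ := ζ r) hf2 hζ2
    have hdχ : (mvfderiv (𝓡 n) (χ r) x : TangentSpace (𝓡 n) x →ₗ[ℝ] ℝ) =
        (deriv φ (f x / r) / r) • (mvfderiv (𝓡 n) f x : TangentSpace (𝓡 n) x →ₗ[ℝ] ℝ) := by
      ext v
      have := mvfderiv_real_comp_apply (I := 𝓡 n) (hζd r (f x)) hfd v
      simpa [hχ, Function.comp_def] using this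
    have hχcomp : χ r = ζ r ∘ f := rfl
    rw [hχcomp, hΔ, ← hχcomp, hdχ, g.innerDual_smul_right, hdV x, hζ'' r, hζ' r]
    rw [show g.innerDual x (mvfderiv (𝓡 n) f x : TangentSpace (𝓡 n) x →ₗ[ℝ] ℝ)
      (mvfderiv (𝓡 n) f x : TangentSpace (𝓡 n) x →ₗ[ℝ] ℝ) = g.gradSq f x from rfl, hΔf x, hgradf x]
    ring
  refine ⟨hχs, ?_, ?_, ?_, ?_, ?_⟩
  · -- compact support inside `{f ≤ 2r}`
    refine HasCompactSupport.intro (hprop (2 * r)) fun x hx ↦ ?_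
    have hx' : 2 * r < f x := lt_of_not_ge hx
    exact hφ0 _ (by rw [le_div_iff₀ hr0]; linarith)
  · intro x
    exact hφ01 _
  · intro x hx
    exact hφ1 _ (by rwa [div_le_one hr0])
  · intro x
    rw [hL x]
    by_cases hx : 1 ≤ f x / r ∧ f x / r ≤ 2
    · -- on the transition region `r ≤ f ≤ 2r`
      have hfr : r ≤ f x := by rw [le_div_iff₀ hr0] at hx; linarith [hx.1]
      have hf2r : f x ≤ 2 * r := by have := hx.2; rw [div_le_iff₀ hr0] at this; linarith
      have h1 : |deriv (deriv φ) (f x / r) / r / r * g.gradSq f x| ≤ 2 * Cφ := by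
        rw [abs_mul, abs_of_nonneg (g.gradSq_nonneg hg f x), abs_div, abs_div,
          abs_of_pos hr0]
        have hgr : g.gradSq f x ≤ 2 * r := (hgradle x).trans hf2r
        calc |deriv (deriv φ) (f x / r)| / r / r * g.gradSq f x
            ≤ Cφ / r / r * (2 * r) :=
              mul_le_mul (div_le_div_of_nonneg_right
                (div_le_div_of_nonneg_right (hCφ2 _) hr0.le) hr0.le) hgr
                (g.gradSq_nonneg hg f x) (div_nonneg (div_nonneg hCφ0 hr0.le) hr0.le)
          _ = 2 * Cφ / r := by field_simp
          _ ≤ 2 * Cφ := div_le_self (by positivity) hr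
      have h2 : |deriv φ (f x / r) / r * (n / 2 - f x)| ≤ Cφ * (n / 2 + 2) := by
        rw [abs_mul, abs_div, abs_of_pos hr0]
        have hn0 : (0 : ℝ) ≤ n := Nat.cast_nonneg n
        have hnf : |(n : ℝ) / 2 - f x| ≤ n / 2 + 2 * r := by
          rw [abs_le]; constructor <;> linarith [hf0 x, hf2r, hr]
        calc |deriv φ (f x / r)| / r * |(n : ℝ) / 2 - f x|
            ≤ Cφ / r * (n / 2 + 2 * r) :=
              mul_le_mul (div_le_div_of_nonneg_right (hCφ1 _) hr0.le) hnf (abs_nonneg _)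
                (div_nonneg hCφ0 hr0.le)
          _ = Cφ * ((n / 2) / r + 2) := by field_simp
          _ ≤ Cφ * (n / 2 + 2) :=
              mul_le_mul_of_nonneg_left
                (add_le_add_left (div_le_self (by positivity : (0 : ℝ) ≤ n / 2) hr) 2) hCφ0
      calc _ ≤ |deriv (deriv φ) (f x / r) / r / r * g.gradSq f x|
            + |deriv φ (f x / r) / r * (n / 2 - f x)| := abs_add_le _ _
        _ ≤ 2 * Cφ + Cφ * (n / 2 + 2) := add_le_add h1 h2
    · -- off the transition region both derivatives of the profile vanish
      rw [not_and_or, not_le, not_le] at hx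
      have hz : deriv φ (f x / r) = 0 ∧ deriv (deriv φ) (f x / r) = 0 := by
        rcases hx with hx | hx
        · exact hφd0 _ hx
        · -- `f/r > 2`: `φ` is locally `0`
          have hev : φ =ᶠ[𝓝 (f x / r)] fun _ ↦ (0 : ℝ) := by
            filter_upwards [Ioi_mem_nhds hx] with s hs
            exact hφ0 s (le_of_lt hs)
          have h1 : deriv φ =ᶠ[𝓝 (f x / r)] fun _ ↦ (0 : ℝ) := by
            have h := hev.deriv; simp only [deriv_const'] at h; exact h
          exact ⟨by simpa using h1.self_of_nhds, by rw [h1.deriv_eq]; simp⟩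
      rw [hz.1, hz.2]
      simp only [zero_div, zero_mul, add_zero, abs_zero]
      positivity
  · intro x hx
    rw [hL x]
    have hz := hφd0 (f x / r) (by rwa [div_lt_one hr0])
    rw [hz.1, hz.2]
    simp

end ShrinkerCutoff


/-! ### Green's identity for the weighted Laplacian under integrability hypotheses (proper exhaustion) -/

section WeightedGreenProper

variable {n : ℕ} {M : Type uM} [TopologicalSpace M] [T2Space M]
  [ChartedSpace (EuclideanSpace ℝ (Fin n)) M] [IsManifold (𝓡 n) ∞ M]
  [T3Space M] [MeasurableSpace M] [BorelSpace M]
  {g : PseudoRiemannianMetric (𝓡 n) ∞ (EuclideanSpace ℝ (Fin n)) (TangentSpace (𝓡 n) : M → Type _)}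
  [g.HasLeviCivita]

omit [T2Space M] in
/-- **Green's identity for the weighted Laplacian on a manifold exhausted by a proper smooth
function, under integrability hypotheses**: for `a ∈ C¹`, `b ∈ C²`, `V ∈ C¹`, `ρ` smooth and
proper, if `a Δb e^{-V}`, `a g⁻¹(dV, db) e^{-V}`, `g⁻¹(da, db) e^{-V}` and `a g⁻¹(dρ, db) e^{-V}`
are integrable then `∫ a (Lb) e^{-V} dV_g = −∫ g⁻¹(da, db) e^{-V} dV_g`, `L = Δ_g − g⁻¹(dV, d·)`
(Green's first identity for the `C¹` function `a e^{-V}`,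
`integral_mul_dalembertian_eq_neg_integral_innerDual_of_proper`). This is the form of the
integrations by parts on the complete shrinker in Li–Wang 2020, §5 (Lemma 5.6, proof of Prop. 5.7),
where the potential `f` is the exhaustion. [cite: LiWang2020, Lemma 5.6 and proof of Prop. 5.7 (arXiv pp. 18–20)] -/
theorem integral_mul_weightedLaplacian_of_proper (hg : g.IsRiemannian) {ρ a b V : M → ℝ}
    (hρ : ContMDiff (𝓡 n) 𝓘(ℝ, ℝ) ∞ ρ) (hprop : ∀ R : ℝ, IsCompact {x | ρ x ≤ R})
    (ha : ContMDiff (𝓡 n) 𝓘(ℝ, ℝ) 1 a) (hb : ContMDiff (𝓡 n) 𝓘(ℝ, ℝ) 2 b)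
    (hV : ContMDiff (𝓡 n) 𝓘(ℝ, ℝ) 1 V)
    (h1 : Integrable (fun x ↦ a x * g.dalembertian b x * Real.exp (-V x)) g.riemVolume)
    (h2 : Integrable (fun x ↦ a x * g.innerDual x (mvfderiv (𝓡 n) V x : TangentSpace (𝓡 n) x →ₗ[ℝ] ℝ)
      (mvfderiv (𝓡 n) b x : TangentSpace (𝓡 n) x →ₗ[ℝ] ℝ) * Real.exp (-V x)) g.riemVolume)
    (h3 : Integrable (fun x ↦ g.innerDual x (mvfderiv (𝓡 n) a x : TangentSpace (𝓡 n) x →ₗ[ℝ] ℝ)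
      (mvfderiv (𝓡 n) b x : TangentSpace (𝓡 n) x →ₗ[ℝ] ℝ) * Real.exp (-V x)) g.riemVolume)
    (h4 : Integrable (fun x ↦ a x * g.innerDual x (mvfderiv (𝓡 n) ρ x : TangentSpace (𝓡 n) x →ₗ[ℝ] ℝ)
      (mvfderiv (𝓡 n) b x : TangentSpace (𝓡 n) x →ₗ[ℝ] ℝ) * Real.exp (-V x)) g.riemVolume) :
    ∫ x, a x * (g.dalembertian b x
        - g.innerDual x (mvfderiv (𝓡 n) V x : TangentSpace (𝓡 n) x →ₗ[ℝ] ℝ)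
            (mvfderiv (𝓡 n) b x : TangentSpace (𝓡 n) x →ₗ[ℝ] ℝ)) * Real.exp (-V x) ∂g.riemVolume =
      -∫ x, g.innerDual x (mvfderiv (𝓡 n) a x : TangentSpace (𝓡 n) x →ₗ[ℝ] ℝ)
          (mvfderiv (𝓡 n) b x : TangentSpace (𝓡 n) x →ₗ[ℝ] ℝ) * Real.exp (-V x) ∂g.riemVolume := by
  have hw1 : ContMDiff (𝓡 n) 𝓘(ℝ, ℝ) 1 (fun x ↦ Real.exp (-V x)) :=
    ((Real.contDiff_exp.comp contDiff_neg).of_le le_top).comp_contMDiff hV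
  have hu1 : ContMDiff (𝓡 n) 𝓘(ℝ, ℝ) 1 (fun x ↦ a x * Real.exp (-V x)) := ha.mul hw1
  have had : ∀ x, MDifferentiableAt (𝓡 n) 𝓘(ℝ, ℝ) a x := fun x ↦ ha.mdifferentiableAt one_ne_zero
  have hVd : ∀ x, MDifferentiableAt (𝓡 n) 𝓘(ℝ, ℝ) V x := fun x ↦ hV.mdifferentiableAt one_ne_zero
  set GVb : M → ℝ := fun x ↦ g.innerDual x (mvfderiv (𝓡 n) V x : TangentSpace (𝓡 n) x →ₗ[ℝ] ℝ)
      (mvfderiv (𝓡 n) b x : TangentSpace (𝓡 n) x →ₗ[ℝ] ℝ) with hGVbdef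
  set Gab : M → ℝ := fun x ↦ g.innerDual x (mvfderiv (𝓡 n) a x : TangentSpace (𝓡 n) x →ₗ[ℝ] ℝ)
      (mvfderiv (𝓡 n) b x : TangentSpace (𝓡 n) x →ₗ[ℝ] ℝ) with hGabdef
  -- the three provisos of the unweighted identity for `u = a e^{-V}`, `w = b`
  have huΔ : Integrable (fun x ↦ (a x * Real.exp (-V x)) * g.dalembertian b x) g.riemVolume :=
    h1.congr (Eventually.of_forall fun x ↦ by ring)
  have hpt : ∀ x, g.innerDual x (mvfderiv (𝓡 n) (fun y ↦ a y * Real.exp (-V y)) x :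
      TangentSpace (𝓡 n) x →ₗ[ℝ] ℝ) (mvfderiv (𝓡 n) b x : TangentSpace (𝓡 n) x →ₗ[ℝ] ℝ) =
      Gab x * Real.exp (-V x) - a x * GVb x * Real.exp (-V x) := by
    intro x
    rw [innerDual_mvfderiv_mul_exp_neg (had x) (hVd x)]
    simp only [hGabdef, hGVbdef]
    ring
  have hduw : Integrable (fun x ↦ g.innerDual x (mvfderiv (𝓡 n) (fun y ↦ a y * Real.exp (-V y)) x :
      TangentSpace (𝓡 n) x →ₗ[ℝ] ℝ) (mvfderiv (𝓡 n) b x : TangentSpace (𝓡 n) x →ₗ[ℝ] ℝ))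
      g.riemVolume := (h3.sub h2).congr (Eventually.of_forall fun x ↦ (hpt x).symm)
  have hcross : Integrable (fun x ↦ (a x * Real.exp (-V x)) * g.innerDual x
      (mvfderiv (𝓡 n) ρ x : TangentSpace (𝓡 n) x →ₗ[ℝ] ℝ)
      (mvfderiv (𝓡 n) b x : TangentSpace (𝓡 n) x →ₗ[ℝ] ℝ)) g.riemVolume :=
    h4.congr (Eventually.of_forall fun x ↦ by ring)
  have hG := integral_mul_dalembertian_eq_neg_integral_innerDual_of_proper hg hρ hprop hu1 hb
    huΔ hduw hcross
  -- rewrite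
  have hL : ∫ x, a x * (g.dalembertian b x - GVb x) * Real.exp (-V x) ∂g.riemVolume =
      ∫ x, ((a x * Real.exp (-V x)) * g.dalembertian b x - a x * GVb x * Real.exp (-V x))
        ∂g.riemVolume := integral_congr_ae (Eventually.of_forall fun x ↦ by ring)
  rw [hL, integral_sub huΔ h2, hG, integral_congr_ae (Eventually.of_forall hpt),
    integral_sub h3 h2]
  ring

end WeightedGreenProper

/-! ### The second moment of the shrinker measure: `∫ f² e^{-f} dV < ∞` -/

section SecondMoment

variable {n : ℕ} {M : Type uM} [TopologicalSpace M] [T2Space M] [SecondCountableTopology M]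
  [ChartedSpace (EuclideanSpace ℝ (Fin n)) M] [IsManifold (𝓡 n) ∞ M]
  [T3Space M] [MeasurableSpace M] [BorelSpace M]
  {g : PseudoRiemannianMetric (𝓡 n) ∞ (EuclideanSpace ℝ (Fin n)) (TangentSpace (𝓡 n) : M → Type _)}
  [g.HasLeviCivita] {f : M → ℝ}

/-- **`f² e^{-f}` is integrable on a gradient shrinker with proper potential and `R ≥ 0`**
(the second moment of the shrinker measure; cf. Li–Wang 2020, (E107) / Lemma 2.x: polynomial
weights are integrable against `e^{-f}`). Proof, by the weighted-volume trick with cut-offs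
`χ_k = φ(f/(k+1))`, `φ' ≤ 0`: Green's identity for the compactly supported `χ_k f` against
`Lf = n/2 − f` gives `∫ χ_k f (f − n/2) e^{-f} = ∫ (χ_k + f φ'(f/(k+1))/(k+1)) |∇f|² e^{-f}
≤ ∫ χ_k |∇f|² e^{-f} ≤ ∫ f e^{-f}` (`|∇f|² = f − R ≤ f`), whence `∫ χ_k f² e^{-f} ≤ (n/2 + 1) ∫ f e^{-f}`
and Fatou. [cite: LiWang2020, §2 (integrability of polynomial weights against e^{-f})] -/
theorem integrable_sq_potential_mul_exp_neg (hg : g.IsRiemannian) (hf : ContMDiff (𝓡 n) 𝓘(ℝ, ℝ) ∞ f)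
    (hsol : ∀ (x : M) (X Y : TangentSpace (𝓡 n) x),
      g.ricci x X Y + g.hessian f x X Y = (1 / 2 : ℝ) * g.val x X Y)
    (hnorm : ∀ x : M, g.scalarCurvature x + g.gradSq f x = f x)
    (hS : ∀ x, 0 ≤ g.scalarCurvature x) (hprop : ∀ c : ℝ, IsCompact {x | f x ≤ c})
    (hfw : Integrable (fun x ↦ f x * Real.exp (-f x)) g.riemVolume) :
    Integrable (fun x ↦ f x ^ 2 * Real.exp (-f x)) g.riemVolume := by
  haveI : LocallyCompactSpace M := Manifold.locallyCompact_of_finiteDimensional (𝓡 n)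
  haveI := isFiniteMeasureOnCompacts_riemVolume (g := g) hg
  -- the soliton identities
  have hgradf : ∀ x, g.gradSq f x = f x - g.scalarCurvature x := fun x ↦ by linarith [hnorm x]
  have hLf : ∀ x, g.dalembertian f x - g.innerDual x (mvfderiv (𝓡 n) f x : TangentSpace (𝓡 n) x →ₗ[ℝ] ℝ)
      (mvfderiv (𝓡 n) f x : TangentSpace (𝓡 n) x →ₗ[ℝ] ℝ) = n / 2 - f x := fun x ↦ by
    rw [show g.innerDual x (mvfderiv (𝓡 n) f x : TangentSpace (𝓡 n) x →ₗ[ℝ] ℝ)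
      (mvfderiv (𝓡 n) f x : TangentSpace (𝓡 n) x →ₗ[ℝ] ℝ) = g.gradSq f x from rfl, hgradf x]
    linarith [scalarCurvature_add_dalembertian hsol x]
  have hf0 : ∀ x, 0 ≤ f x := fun x ↦ by linarith [hnorm x, hS x, g.gradSq_nonneg hg f x]
  have hgradle : ∀ x, g.gradSq f x ≤ f x := fun x ↦ by linarith [hgradf x, hS x]
  have hf1 : ContMDiff (𝓡 n) 𝓘(ℝ, ℝ) 1 f := hf.of_le (by norm_num)
  have hf2 : ContMDiff (𝓡 n) 𝓘(ℝ, ℝ) 2 f := hf.of_le (WithTop.coe_le_coe.mpr le_top)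
  have hfd : ∀ x, MDifferentiableAt (𝓡 n) 𝓘(ℝ, ℝ) f x := fun x ↦ hf.mdifferentiableAt (by simp)
  set w : M → ℝ := fun x ↦ Real.exp (-f x) with hwdef
  have hwc : Continuous w := Real.continuous_exp.comp hf.continuous.neg
  have hw0 : ∀ x, 0 ≤ w x := fun x ↦ (Real.exp_pos _).le
  -- the antitone profile and the cut-offs
  obtain ⟨φ, hφs, hφ1, hφ0, hφ01, hφanti⟩ := exists_antitone_cutoffProfile
  have hφ' : ∀ t, deriv φ t ≤ 0 := fun t ↦ hφanti.deriv_nonpos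
  set ζ : ℕ → ℝ → ℝ := fun k t ↦ φ (t / (k + 1)) with hζ
  have hζs : ∀ k, ContDiff ℝ ∞ (ζ k) := fun k ↦ hφs.comp (contDiff_id.div_const _)
  have hζd : ∀ k t, HasDerivAt (ζ k) (deriv φ (t / (k + 1)) / (k + 1)) t := fun k t ↦ by
    have h1 : HasDerivAt (fun s : ℝ ↦ s / (k + 1)) (1 / (k + 1)) t := (hasDerivAt_id t).div_const _
    have h2 : HasDerivAt φ (deriv φ (t / (k + 1))) (t / (k + 1)) :=
      (hφs.differentiable (by simp) _).hasDerivAt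
    simpa [hζ, div_eq_mul_inv, Function.comp_def] using h2.comp t h1
  set χ : ℕ → M → ℝ := fun k x ↦ ζ k (f x) with hχ
  have hχs : ∀ k, ContMDiff (𝓡 n) 𝓘(ℝ, ℝ) ∞ (χ k) := fun k ↦ (hζs k).comp_contMDiff hf
  have hχ1 : ∀ k, ContMDiff (𝓡 n) 𝓘(ℝ, ℝ) 1 (χ k) := fun k ↦ (hχs k).of_le (by norm_num)
  have hχc : ∀ k : ℕ, HasCompactSupport (χ k) := fun k ↦ by
    refine HasCompactSupport.intro (hprop (2 * (k + 1))) fun x hx ↦ ?_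
    have hx' : 2 * ((k : ℝ) + 1) < f x := lt_of_not_ge hx
    have hk : (0 : ℝ) < k + 1 := by positivity
    exact hφ0 _ (by rw [le_div_iff₀ hk]; linarith)
  have hχ01 : ∀ k x, 0 ≤ χ k x ∧ χ k x ≤ 1 := fun k x ↦ hφ01 _
  have hχ_lim : ∀ x, Tendsto (fun k ↦ χ k x) atTop (𝓝 1) := fun x ↦ by
    refine tendsto_const_nhds.congr' ?_
    obtain ⟨N, hN⟩ := exists_nat_ge (f x)
    filter_upwards [eventually_ge_atTop N] with k hk
    refine (hφ1 _ ?_).symm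
    rw [div_le_one (by positivity)]
    calc f x ≤ N := hN
      _ ≤ k := by exact_mod_cast hk
      _ ≤ k + 1 := by linarith
  -- the differential of `χ_k f`
  have hdχf : ∀ k x, (mvfderiv (𝓡 n) (fun y ↦ χ k y * f y) x : TangentSpace (𝓡 n) x →ₗ[ℝ] ℝ) =
      (χ k x + f x * (deriv φ (f x / (k + 1)) / (k + 1))) •
        (mvfderiv (𝓡 n) f x : TangentSpace (𝓡 n) x →ₗ[ℝ] ℝ) := by
    intro k x
    have hχd : MDifferentiableAt (𝓡 n) 𝓘(ℝ, ℝ) (χ k) x := (hχs k).mdifferentiableAt (by simp)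
    have hdχ : ∀ v, mvfderiv (𝓡 n) (χ k) x v = deriv φ (f x / (k + 1)) / (k + 1) * mvfderiv (𝓡 n) f x v := by
      intro v
      have := mvfderiv_real_comp_apply (I := 𝓡 n) (hζd k (f x)) (hfd x) v
      simpa [hχ, Function.comp_def] using this
    ext v
    have hm := mvfderiv_fun_mul hχd (hfd x)
    simp only [ContinuousLinearMap.coe_coe, LinearMap.smul_apply, smul_eq_mul]
    rw [hm]
    simp only [add_apply, smul_apply, smul_eq_mul, hdχ v]
    ring
  -- the cut-off integrals are bounded: `∫ χ_k f² e^{-f} ≤ (n/2 + 1) ∫ f e^{-f}`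
  set K₀ : ℝ := ((n : ℝ) / 2 + 1) * ∫ x, f x * Real.exp (-f x) ∂g.riemVolume with hK₀
  have hbound : ∀ k, ∫ x, χ k x * (f x ^ 2 * Real.exp (-f x)) ∂g.riemVolume ≤ K₀ := by
    intro k
    -- Green's identity for `χ_k f` against `Lf = n/2 − f`
    have hcf : ContMDiff (𝓡 n) 𝓘(ℝ, ℝ) 1 (fun y ↦ χ k y * f y) := (hχ1 k).mul hf1
    have hcfc : HasCompactSupport (fun y ↦ χ k y * f y) := (hχc k).mul_right
    have hG := integral_cutoff_mul_weightedLaplacian hg (V := f) hcf hcfc hf2 hf1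
    -- left side: `∫ χ f (n/2 − f) e^{-f}`; right side: `−∫ (χ + f φ'/(k+1)) |∇f|² e^{-f}`
    have hGl : ∫ x, (χ k x * f x) * (g.dalembertian f x
        - g.innerDual x (mvfderiv (𝓡 n) f x : TangentSpace (𝓡 n) x →ₗ[ℝ] ℝ)
            (mvfderiv (𝓡 n) f x : TangentSpace (𝓡 n) x →ₗ[ℝ] ℝ)) * Real.exp (-f x) ∂g.riemVolume =
        ∫ x, ((n : ℝ) / 2 * (χ k x * (f x * Real.exp (-f x)))
          - χ k x * (f x ^ 2 * Real.exp (-f x))) ∂g.riemVolume :=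
      integral_congr_ae (Eventually.of_forall fun x ↦ by dsimp only; rw [hLf x]; ring)
    have hGr : ∫ x, g.innerDual x (mvfderiv (𝓡 n) (fun y ↦ χ k y * f y) x : TangentSpace (𝓡 n) x →ₗ[ℝ] ℝ)
        (mvfderiv (𝓡 n) f x : TangentSpace (𝓡 n) x →ₗ[ℝ] ℝ) * Real.exp (-f x) ∂g.riemVolume =
        ∫ x, (χ k x * (g.gradSq f x * Real.exp (-f x))
          + f x * (deriv φ (f x / (k + 1)) / (k + 1)) * g.gradSq f x * Real.exp (-f x)) ∂g.riemVolume :=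
      integral_congr_ae (Eventually.of_forall fun x ↦ by
        dsimp only
        rw [hdχf k x, g.innerDual_smul_left,
          show g.innerDual x (mvfderiv (𝓡 n) f x : TangentSpace (𝓡 n) x →ₗ[ℝ] ℝ)
            (mvfderiv (𝓡 n) f x : TangentSpace (𝓡 n) x →ₗ[ℝ] ℝ) = g.gradSq f x from rfl]
        ring)
    -- integrability of the four compactly supported continuous integrands
    have hΓc : Continuous (g.gradSq f) := (contMDiff_gradSq g hf).continuous
    have hχkc : Continuous (χ k) := (hχs k).continuous
    have hφ'c : Continuous (fun x ↦ deriv φ (f x / (k + 1)) / (k + 1)) :=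
      ((hφs.continuous_deriv (by simp)).comp (hf.continuous.div_const _)).div_const _
    have i1 : Integrable (fun x ↦ (n : ℝ) / 2 * (χ k x * (f x * Real.exp (-f x)))) g.riemVolume :=
      ((hχkc.mul (hf.continuous.mul hwc)).integrable_of_hasCompactSupport
        (hχc k).mul_right).const_mul _
    have i2 : Integrable (fun x ↦ χ k x * (f x ^ 2 * Real.exp (-f x))) g.riemVolume :=
      (hχkc.mul ((hf.continuous.pow 2).mul hwc)).integrable_of_hasCompactSupport (hχc k).mul_right
    have i3 : Integrable (fun x ↦ χ k x * (g.gradSq f x * Real.exp (-f x))) g.riemVolume :=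
      (hχkc.mul (hΓc.mul hwc)).integrable_of_hasCompactSupport (hχc k).mul_right
    have i4 : Integrable (fun x ↦ f x * (deriv φ (f x / (k + 1)) / (k + 1)) * g.gradSq f x
        * Real.exp (-f x)) g.riemVolume := by
      -- supported in `tsupport (χ k)`? No: supported where `φ' ≠ 0 ⊆ {f ≤ 2(k+1)}`
      refine (((hf.continuous.mul hφ'c).mul hΓc).mul hwc).integrable_of_hasCompactSupport ?_
      refine HasCompactSupport.intro (hprop (2 * (k + 1))) fun x hx ↦ ?_
      have hx' : 2 * ((k : ℝ) + 1) < f x := lt_of_not_ge hx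
      have hk : (0 : ℝ) < k + 1 := by positivity
      have hgt : 2 < f x / (k + 1) := by rw [lt_div_iff₀ hk]; linarith
      have hev : φ =ᶠ[𝓝 (f x / (k + 1))] fun _ ↦ (0 : ℝ) := by
        filter_upwards [Ioi_mem_nhds hgt] with s hs
        exact hφ0 s (le_of_lt hs)
      have hz : deriv φ (f x / (k + 1)) = 0 := by rw [hev.deriv_eq]; simp
      simp [hz]
    rw [hGl, hGr, integral_sub i1 i2, integral_add i3 i4, integral_const_mul] at hG
    -- signs: `f φ' |∇f|² e^{-f} ≤ 0`, `χ |∇f|² e^{-f} ≤ χ f e^{-f} ≤ f e^{-f}`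
    have hneg : ∫ x, f x * (deriv φ (f x / (k + 1)) / (k + 1)) * g.gradSq f x * Real.exp (-f x)
        ∂g.riemVolume ≤ 0 :=
      integral_nonpos fun x ↦ mul_nonpos_of_nonpos_of_nonneg
        (mul_nonpos_of_nonpos_of_nonneg (mul_nonpos_of_nonneg_of_nonpos (hf0 x)
          (div_nonpos_of_nonpos_of_nonneg (hφ' _) (by positivity))) (g.gradSq_nonneg hg f x)) (hw0 x)
    have hle3 : ∫ x, χ k x * (g.gradSq f x * Real.exp (-f x)) ∂g.riemVolume ≤
        ∫ x, f x * Real.exp (-f x) ∂g.riemVolume :=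
      integral_mono_of_nonneg (Eventually.of_forall fun x ↦ mul_nonneg (hχ01 k x).1
        (mul_nonneg (g.gradSq_nonneg hg f x) (hw0 x))) hfw (Eventually.of_forall fun x ↦ by
          have h1 := (hχ01 k x).2; have h0 := (hχ01 k x).1
          have := hgradle x; have := hw0 x; have := g.gradSq_nonneg hg f x
          calc χ k x * (g.gradSq f x * Real.exp (-f x)) ≤ 1 * (f x * Real.exp (-f x)) := by
                gcongr
            _ = f x * Real.exp (-f x) := one_mul _)
    have hle1 : ∫ x, χ k x * (f x * Real.exp (-f x)) ∂g.riemVolume ≤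
        ∫ x, f x * Real.exp (-f x) ∂g.riemVolume :=
      integral_mono_of_nonneg (Eventually.of_forall fun x ↦ mul_nonneg (hχ01 k x).1
        (mul_nonneg (hf0 x) (hw0 x))) hfw (Eventually.of_forall fun x ↦ by
          have h1 := (hχ01 k x).2
          have : 0 ≤ f x * Real.exp (-f x) := mul_nonneg (hf0 x) (hw0 x)
          nlinarith)
    have hn0 : (0 : ℝ) ≤ n / 2 := by positivity
    rw [hK₀]
    nlinarith [hG, hneg, hle3, hle1, mul_le_mul_of_nonneg_left hle1 hn0]
  -- Fatou
  refine integrable_of_forall_integral_cutoff_mul_le (χ := χ)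
    (((hf.continuous.pow 2).mul hwc).aestronglyMeasurable) (fun x ↦ mul_nonneg (sq_nonneg _) (hw0 x))
    (fun k x ↦ (hχ01 k x).1) (fun k ↦ ?_) hχ_lim hbound
  exact ((hχs k).continuous.mul ((hf.continuous.pow 2).mul hwc)).integrable_of_hasCompactSupport
    (hχc k).mul_right

end SecondMoment


end Literature.Geometry.Riemannian

end
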